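import Summits.BirchSwinnertonDyer.BirchSwinnertonDyer.Theorems.TameQuarticManinParityIIIstarHasTameGoodModel
import HarnessLib

/-!
# Route `TameQuarticManinParity`: the two ČNS halves (`TprimeIrrManinUnitOfDegreePrimeToThree`, stmt-24499;
# `TprimeRedManinUnitOfDegreePrimeToThree`, stmt-24628) follow from the Néron-cotangent CARRIER alone —
# `nonempty_tameNeronFormsAt → …`, BY NAME over S41/S41* and the typer's (C1)/(C3) (`--supports` 24499; CONDITIONAL)

Cell `pub/bsd-wall`, D-0145 line `route-BirchSwinnertonDyer-TeichmullerTwistDescent`, seat `bsd-line-ttd-p1` g15.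
BSD is NOT proved by this; Manin's conjecture is not proved by this; the two ČNS halves stay OPEN (they are closed
elsewhere modulo the cite-only ČNS Thm 1.2 fact `cesnaviciusNeururerSaha_padicVal_maninConstant_le_modularDegree`).
What this file adds: an ALTERNATIVE print leaf — the carrier existence `nonempty_tameNeronFormsAt` (ČNS Thm 5.15 /
Thm 6.12 (b), the leaf the LINE 38–43 cell statements already consume) also yields both halves, on EVERY (t′) row
(III via S41 `HasTameGoodModel 3 8 W 2`, III* via S41* `HasTameGoodModel 3 8 W 6`), through the typer's (C3)
`tameColength_eq_zero_of_not_dvd_modularDegree` and (C1) `not_dvd_maninConstant_iff_tameColength_le_of_hasTameGoodModel`.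
So the route's Manin binder has a single print leaf family {carrier existence / latticeCriterion} besides its cruxes.
THEOREMS ONLY; axioms `propext`, `Classical.choice`, `Quot.sound`.
-/

set_option autoImplicit false
-- D-0017: single-problem summit, so `Summit.BirchSwinnertonDyer.BirchSwinnertonDyer.…` repeats a namespace BY DESIGN.
set_option linter.dupNamespace false

namespace Summit.BirchSwinnertonDyer.BirchSwinnertonDyer.Theorems.TameQuarticManinParity

open Summit.BirchSwinnertonDyer.BirchSwinnertonDyer.Theses.TameQuarticManinParity
open Literature.NumberTheory.EllipticCurves.ModularForms
open Summit.BirchSwinnertonDyer.Rank1Residual.Additive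

/-- **`3 ∤ deg φ ⇒ 3 ∤ c` on every (t′) row, from the carrier existence** (no Galois-image hypothesis used):
`v₃(N) = 2`, a carrier `Λ`, the good model of exponent `2` (III) or `6` (III*), then (C3) `col_K = 0` and (C1).
[cite: CesnaviciusNeururerSaha2023, Lemma 7.1 and Thm. 7.2 (pp. 46–47); Thm. 6.12 (b)] -/
theorem not_three_dvd_maninConstant_of_not_dvd_modularDegree_of_carrier (hne : nonempty_tameNeronFormsAt)
    (W : WeierstrassCurve ℚ) [W.IsElliptic] [W.IsGloballyMinimal] [NeZero (W.conductorNorm ℤ)]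
    (hadd : Literature.NumberTheory.EllipticCurves.Rank1Residual.Addv W 3) (ht : SubTprime W 3)
    (D : ModularParametrizationData W (W.conductorNorm ℤ))
    (hopt : ∀ z ∈ D.L.lattice, ∃ w ∈ periodLattice D.f, z = D.c * w) (hdeg : ¬ 3 ∣ D.modularDegree) :
    ¬ (3 : ℤ) ∣ D.maninConstant := by
  have h2 := padicValNat_conductorNorm_eq_two_of_subTprime W ht
  obtain ⟨Λ⟩ := nonempty_tameNeronFormsAt_three hne (W.conductorNorm ℤ) h2
  rcases TwistPairAtThree.padicValInt_eq_three_or_nine_of_subTprime W hadd ht with h3 | h9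
  · have hgood := IIIGoodModel.tprimeIIIHasTameGoodModel_proof W hadd ht h3
    have h0 := Λ.tameColength_eq_zero_of_not_dvd_modularDegree Nat.prime_three (by norm_num) D hopt hgood hdeg
    exact (Λ.not_dvd_maninConstant_iff_tameColength_le_of_hasTameGoodModel Nat.prime_three (by norm_num) D hopt
      hgood).2 (by omega)
  · have hgood := IIIstarGoodModel.hasTameGoodModel_six_of_subTprime_of_padicValInt_eq_nine W hadd ht h9
    have h0 := Λ.tameColength_eq_zero_of_not_dvd_modularDegree Nat.prime_three (by norm_num) D hopt hgood hdeg
    exact (Λ.not_dvd_maninConstant_iff_tameColength_le_of_hasTameGoodModel Nat.prime_three (by norm_num) D hopt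
      hgood).2 (by omega)

/-- **The irreducible ČNS half (stmt-24499) from the carrier existence**, by name. [cite: CesnaviciusNeururerSaha2023, Thm. 1.2] -/
theorem tprimeIrrManinUnitOfDegreePrimeToThree_of_carrier (hne : nonempty_tameNeronFormsAt) :
    TprimeIrrManinUnitOfDegreePrimeToThree := by
  unfold TprimeIrrManinUnitOfDegreePrimeToThree
  intro W _ _ _ _hCM hadd ht _hirr D hopt _hmin hdeg
  exact not_three_dvd_maninConstant_of_not_dvd_modularDegree_of_carrier hne W hadd ht D hopt hdeg

/-- **The reducible ČNS half (stmt-24628) from the carrier existence**, by name. [cite: CesnaviciusNeururerSaha2023, Thm. 1.2] -/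
theorem tprimeRedManinUnitOfDegreePrimeToThree_of_carrier (hne : nonempty_tameNeronFormsAt) :
    TprimeRedManinUnitOfDegreePrimeToThree := by
  unfold TprimeRedManinUnitOfDegreePrimeToThree
  intro W _ _ _ _hCM hadd ht _hred D hopt _hmin hdeg
  exact not_three_dvd_maninConstant_of_not_dvd_modularDegree_of_carrier hne W hadd ht D hopt hdeg

end Summit.BirchSwinnertonDyer.BirchSwinnertonDyer.Theorems.TameQuarticManinParity
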